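import Mathlib.Data.Real.Basic
import Mathlib.Tactic.Linarith
import Mathlib.Tactic.Positivity
import Mathlib.Tactic.FieldSimp
import HarnessLib
import HarnessLib.Audit

/-!
# `NoHeavyLowerTail` (crux stmt-CriticalPhenomena-4575), Sahi programme P4 (Holley / monotone coupling):
# the maj-slot certificate on the pattern `2³` — I: regime A (top full, uniform rank-2 fill) — the two halves with explicit retained masses

Support file (cell `prim-l12`, seat P4, generation 9; `--supports stmt-CriticalPhenomena-4575`).  No named facts, no
sorries; standard axioms; pure real algebra.  The proofs are machine-found certificates: every item is closed by `linarith` from an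
explicit nonnegative combination of the listed facts (an exact rational Positivstellensatz-type certificate found by linear
programming over products of the facts with nonnegative aggregate masses, verified in exact arithmetic before emission; generator
and certificates in HOME prim-l12-p4/code/gen9, memo FROM-prim-l12-p4-gen9-MAJ-SLOT-LEAN.md).

Setting (memo HOME prim-l12-p4/FROM-prim-l12-p4-gen8-PATTERN-CERTIFICATES.md §4b): the pattern `2³` of three join-primes with the
majority slot `MAJ = {ij, ik, jk, ⊤}`; for a labelling `(i, j, k)` of the atoms the eight fibre masses are `nE, ni, nj, nk, nij,
nik, njk, nT` with total `Z` (kept as a symbol; `d = nE+ni+nj+nk`, `u = nij+nik+njk+nT`, NOT normalised); the hypotheses are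
consequences of log-supermodularity of the pattern measure (`…SahiE3MajPatternFacts.facts_of_pattern`); the conclusions are the
validity / up-transport / pair inequalities for retained masses `rij, rik, rjk, rT` (homogeneous of degree three) consumed by
`…SahiE3MajPattern.certificate_of_ineqs`.  Regimes: A (top full, uniform rank-2 fill), A'(k) (top full, Hall(k) tight), B1 (top
only), B2(k) (donors of k drained) — HOME memo §4b; the case analysis is `…SahiE3MajCore.exists_cert`.
-/

namespace Summit.CriticalPhenomena.PercolationContinuityZ3.Theorems.SahiE3MajCert

/-- **Regime A** (top full, uniform rank-2 fill: `r_xy = Z·n_xy·(Z − δ)`, `δ·N₂ = d·n_⊤`, `r_⊤ = Z(Z+d)n_⊤`), valid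
        when `d·n_⊤ ≤ Z·N₂` and the three single-atom Hall inequalities `n_x·n_yz ≤ (d − n_x)·σ_x` hold.
        [this work] Part 1: validity and up-transport, with the explicit retained masses. -/
theorem cert_A_valid (nE ni nj nk nij nik njk nT Z : ℝ)
    (h_nn_E : 0 ≤ nE) (h_nn_0 : 0 ≤ ni) (h_nn_1 : 0 ≤ nj) (h_nn_2 : 0 ≤ nk) (h_nn_01 : 0 ≤ nij) (h_nn_02 : 0 ≤ nik)
    (h_nn_12 : 0 ≤ njk) (h_nn_T : 0 ≤ nT) (h_nn_Z : 0 ≤ Z)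
    (hallA_i : ni * njk ≤ ((nE + ni + nj + nk) - ni) * (nij + nik))
    (hallA_j : nj * nik ≤ ((nE + ni + nj + nk) - nj) * (nij + njk))
    (hallA_k : nk * nij ≤ ((nE + ni + nj + nk) - nk) * (nik + njk)) (hN2pos : 0 < nij + nik + njk) (dl : ℝ)
    (hdl : dl * (nij + nik + njk) = (nE + ni + nj + nk) * nT) (hdl0 : 0 ≤ dl) (hdl1 : dl ≤ Z) :
    0 ≤ (Z*nij*(Z - dl)) ∧
    0 ≤ (Z*nik*(Z - dl)) ∧
    0 ≤ (Z*njk*(Z - dl)) ∧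
    0 ≤
            (Z*(Z + (nE + ni + nj + nk))*nT) ∧
    (Z*nij*(Z - dl)) ≤ Z * (Z + (nE + ni + nj + nk)) * nij ∧
            (Z*nik*(Z - dl)) ≤ Z * (Z + (nE + ni + nj + nk)) * nik ∧
    (Z*njk*(Z - dl)) ≤ Z *
            (Z + (nE + ni + nj + nk)) * njk ∧
    (Z*(Z + (nE + ni + nj + nk))*nT) ≤ Z * (Z + (nE + ni + nj + nk))
            * nT ∧
    Z * (nij + nik + njk + nT) * ni ≤ (Z * (Z + (nE + ni + nj + nk)) * nij - (Z*nij*(Z - dl))) +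
            (Z * (Z + (nE + ni + nj + nk)) * nik - (Z*nik*(Z - dl))) +
            (Z * (Z + (nE + ni + nj + nk)) * nT - (Z*(Z + (nE + ni + nj + nk))*nT)) ∧
    Z *
            (nij + nik + njk + nT) * nj ≤ (Z * (Z + (nE + ni + nj + nk)) * nij - (Z*nij*(Z - dl))) +
            (Z * (Z + (nE + ni + nj + nk)) * njk - (Z*njk*(Z - dl))) +
            (Z * (Z + (nE + ni + nj + nk)) * nT - (Z*(Z + (nE + ni + nj + nk))*nT)) ∧
    Z *
            (nij + nik + njk + nT) * nk ≤ (Z * (Z + (nE + ni + nj + nk)) * nik - (Z*nik*(Z - dl))) +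
            (Z * (Z + (nE + ni + nj + nk)) * njk - (Z*njk*(Z - dl))) +
            (Z * (Z + (nE + ni + nj + nk)) * nT - (Z*(Z + (nE + ni + nj + nk))*nT)) ∧
    (Z*nij*(Z - dl)) +
            (Z*nik*(Z - dl)) + (Z*njk*(Z - dl)) + (Z*(Z + (nE + ni + nj + nk))*nT) = Z * Z * (nij + nik + njk + nT)
            ∧
    Z * Z * nT ≤ (Z*(Z + (nE + ni + nj + nk))*nT) ∧
    Z * Z * (nij + nT) ≤ (Z*nij*(Z - dl)) +
            (Z*(Z + (nE + ni + nj + nk))*nT) ∧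
    Z * Z * (nik + nT) ≤ (Z*nik*(Z - dl)) +
            (Z*(Z + (nE + ni + nj + nk))*nT) ∧
    Z * Z * (njk + nT) ≤ (Z*njk*(Z - dl)) +
            (Z*(Z + (nE + ni + nj + nk))*nT) ∧
    Z * Z * (nij + nik + nT) ≤ (Z*nij*(Z - dl)) + (Z*nik*(Z - dl)) +
            (Z*(Z + (nE + ni + nj + nk))*nT) ∧
    Z * Z * (nij + njk + nT) ≤ (Z*nij*(Z - dl)) + (Z*njk*(Z - dl)) +
            (Z*(Z + (nE + ni + nj + nk))*nT) ∧
    Z * Z * (nik + njk + nT) ≤ (Z*nik*(Z - dl)) + (Z*njk*(Z - dl)) +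
            (Z*(Z + (nE + ni + nj + nk))*nT) := by
  refine ⟨?_, ?_, ?_, ?_, ?_, ?_, ?_, ?_, ?_, ?_, ?_, ?_, ?_, ?_, ?_, ?_, ?_, ?_, ?_⟩
  · -- r_nonneg_01
    linarith only [mul_nonneg (by positivity : (0:ℝ) ≤ (1 : ℝ) * nij * Z) (sub_nonneg.2 hdl1)]
  · -- r_nonneg_02
    linarith only [mul_nonneg (by positivity : (0:ℝ) ≤ (1 : ℝ) * nik * Z) (sub_nonneg.2 hdl1)]
  · -- r_nonneg_12
    linarith only [mul_nonneg (by positivity : (0:ℝ) ≤ (1 : ℝ) * njk * Z) (sub_nonneg.2 hdl1)]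
  · -- r_nonneg_T
    linarith only [(by positivity : (0:ℝ) ≤ (1 : ℝ) * nT * Z * (Z + nE + ni + nj + nk))]
  · -- cap_01
    linarith only [(by positivity : (0:ℝ) ≤ (1 : ℝ) * nij * Z * (nE + ni + nj + nk) + (1 : ℝ) * nij * Z * dl)]
  · -- cap_02
    linarith only [(by positivity : (0:ℝ) ≤ (1 : ℝ) * nik * Z * (nE + ni + nj + nk) + (1 : ℝ) * nik * Z * dl)]
  · -- cap_12
    linarith only [(by positivity : (0:ℝ) ≤ (1 : ℝ) * njk * Z * (nE + ni + nj + nk) + (1 : ℝ) * njk * Z * dl)]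
  · -- cap_T
    linarith only []
  · -- hall_0
    refine le_of_mul_le_mul_left ?_ (a := (nij + nik + njk)) hN2pos
    linarith only [mul_nonneg (by positivity : (0:ℝ) ≤ (1 : ℝ) * Z * (nij + nik + njk + nT))
            (sub_nonneg.2 hallA_i), congrArg (fun z : ℝ => ((1 : ℝ) * nij * Z + (1 : ℝ) * nik * Z) * z) hdl]
  · -- hall_1
    refine le_of_mul_le_mul_left ?_ (a := (nij + nik + njk)) hN2pos
    linarith only [mul_nonneg (by positivity : (0:ℝ) ≤ (1 : ℝ) * Z * (nij + nik + njk + nT))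
            (sub_nonneg.2 hallA_j), congrArg (fun z : ℝ => ((1 : ℝ) * nij * Z + (1 : ℝ) * njk * Z) * z) hdl]
  · -- hall_2
    refine le_of_mul_le_mul_left ?_ (a := (nij + nik + njk)) hN2pos
    linarith only [mul_nonneg (by positivity : (0:ℝ) ≤ (1 : ℝ) * Z * (nij + nik + njk + nT))
            (sub_nonneg.2 hallA_k), congrArg (fun z : ℝ => ((1 : ℝ) * nik * Z + (1 : ℝ) * njk * Z) * z) hdl]
  · -- total
    linarith only [congrArg (fun z : ℝ => ((1 : ℝ) * Z) * z) hdl, congrArg (fun z : ℝ => ((-1 : ℝ) * Z) * z) hdl]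
  · -- ut_T
    linarith only [(by positivity : (0:ℝ) ≤ (1 : ℝ) * nT * Z * (nE + ni + nj + nk))]
  · -- ut_01
    linarith only [congrArg (fun z : ℝ => ((-1 : ℝ) * Z) * z) hdl,
            (by positivity : (0:ℝ) ≤ (1 : ℝ) * Z * dl * (nik + njk))]
  · -- ut_02
    linarith only [congrArg (fun z : ℝ => ((-1 : ℝ) * Z) * z) hdl,
            (by positivity : (0:ℝ) ≤ (1 : ℝ) * Z * dl * (nij + njk))]
  · -- ut_12
    linarith only [congrArg (fun z : ℝ => ((-1 : ℝ) * Z) * z) hdl,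
            (by positivity : (0:ℝ) ≤ (1 : ℝ) * Z * dl * (nij + nik))]
  · -- ut_R0
    linarith only [congrArg (fun z : ℝ => ((-1 : ℝ) * Z) * z) hdl, (by positivity : (0:ℝ) ≤ (1 : ℝ) * njk * Z * dl)]
  · -- ut_R1
    linarith only [congrArg (fun z : ℝ => ((-1 : ℝ) * Z) * z) hdl, (by positivity : (0:ℝ) ≤ (1 : ℝ) * nik * Z * dl)]
  · -- ut_R2
    linarith only [congrArg (fun z : ℝ => ((-1 : ℝ) * Z) * z) hdl, (by positivity : (0:ℝ) ≤ (1 : ℝ) * nij * Z * dl)]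

/-- **Regime A** (top full, uniform rank-2 fill: `r_xy = Z·n_xy·(Z − δ)`, `δ·N₂ = d·n_⊤`, `r_⊤ = Z(Z+d)n_⊤`), valid
        when `d·n_⊤ ≤ Z·N₂` and the three single-atom Hall inequalities `n_x·n_yz ≤ (d − n_x)·σ_x` hold.
        [this work] Part 2: the core pair inequalities with traces `{⊤}` (`↑(xy)` vs `↑(xz)`, `↑(xy)` vs `↑z`),
        explicit retained masses. -/
theorem cert_A_pairs (nE ni nj nk nij nik njk nT Z : ℝ)
    (h_nn_E : 0 ≤ nE) (h_nn_0 : 0 ≤ ni) (h_nn_1 : 0 ≤ nj) (h_nn_2 : 0 ≤ nk) (h_nn_01 : 0 ≤ nij) (h_nn_02 : 0 ≤ nik)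
    (h_nn_12 : 0 ≤ njk) (h_nn_T : 0 ≤ nT) (h_nn_Z : 0 ≤ Z) (h_sum : Z = nE + ni + nj + nk + nij + nik + njk + nT)
    (h_fkg_AA0 : (nij + nT) * (nik + nT) ≤ Z * nT) (h_fkg_AA1 : (nij + nT) * (njk + nT) ≤ Z * nT)
    (h_fkg_AA2 : (nik + nT) * (njk + nT) ≤ Z * nT) (h_fkg_Aa01 : (nij + nT) * (nk + nik + njk + nT) ≤ Z * nT)
    (h_fkg_Aa02 : (nik + nT) * (nj + nij + njk + nT) ≤ Z * nT)
    (h_fkg_Aa12 : (njk + nT) * (ni + nij + nik + nT) ≤ Z * nT) :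
    Z * ((nij + nT) * (nik + nT) + (nik + nT) * (nij + nT)) - (nij + nik + njk + nT) * (nij + nT) * (nik + nT) ≤
            (Z*(Z + (nE + ni + nj + nk))*nT) ∧
    Z * ((nij + nT) * (njk + nT) + (njk + nT) * (nij + nT)) -
            (nij + nik + njk + nT) * (nij + nT) * (njk + nT) ≤ (Z*(Z + (nE + ni + nj + nk))*nT) ∧
    Z *
            ((nik + nT) * (njk + nT) + (njk + nT) * (nik + nT)) - (nij + nik + njk + nT) * (nik + nT) * (njk + nT)
            ≤ (Z*(Z + (nE + ni + nj + nk))*nT) ∧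
    Z * ((nij + nT) * (nik + njk + nT) + (nk + nik + njk + nT) *
            (nij + nT)) - (nij + nik + njk + nT) * (nij + nT) * (nk + nik + njk + nT) ≤
            (Z*(Z + (nE + ni + nj + nk))*nT) ∧
    Z * ((nik + nT) * (nij + njk + nT) + (nj + nij + njk + nT) *
            (nik + nT)) - (nij + nik + njk + nT) * (nik + nT) * (nj + nij + njk + nT) ≤
            (Z*(Z + (nE + ni + nj + nk))*nT) ∧
    Z * ((njk + nT) * (nij + nik + nT) + (ni + nij + nik + nT) *
            (njk + nT)) - (nij + nik + njk + nT) * (njk + nT) * (ni + nij + nik + nT) ≤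
            (Z*(Z + (nE + ni + nj + nk))*nT) := by
  refine ⟨?_, ?_, ?_, ?_, ?_, ?_⟩
  · -- pair_P01_P02
    linarith only [mul_nonneg (by positivity : (0:ℝ) ≤ (1 : ℝ) * (Z + nE + ni + nj + nk)) (sub_nonneg.2 h_fkg_AA0),
            congrArg (fun z : ℝ => ((-1 : ℝ) * nT * nT + (-1 : ℝ) * nij * nT + (-1 : ℝ) * nij * nik + (-1 : ℝ) *
            nik * nT) * z) h_sum]
  · -- pair_P01_P12
    linarith only [mul_nonneg (by positivity : (0:ℝ) ≤ (1 : ℝ) * (Z + nE + ni + nj + nk)) (sub_nonneg.2 h_fkg_AA1),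
            congrArg (fun z : ℝ => ((-1 : ℝ) * nT * nT + (-1 : ℝ) * nij * nT + (-1 : ℝ) * nij * njk + (-1 : ℝ) *
            njk * nT) * z) h_sum]
  · -- pair_P02_P12
    linarith only [mul_nonneg (by positivity : (0:ℝ) ≤ (1 : ℝ) * (Z + nE + ni + nj + nk)) (sub_nonneg.2 h_fkg_AA2),
            congrArg (fun z : ℝ => ((-1 : ℝ) * nT * nT + (-1 : ℝ) * nik * nT + (-1 : ℝ) * nik * njk + (-1 : ℝ) *
            njk * nT) * z) h_sum]
  · -- pair_P01_R2
    linarith only [mul_nonneg (by positivity : (0:ℝ) ≤ (1 : ℝ) * (Z + nE + ni + nj + nk))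
            (sub_nonneg.2 h_fkg_Aa01), congrArg (fun z : ℝ =>
            ((-1 : ℝ) * nT * nT + (-1 : ℝ) * nij * nT + (-1 : ℝ) * nij * nik + (-1 : ℝ) * nij * njk + (-1 : ℝ) *
            nik * nT + (-1 : ℝ) * njk * nT + ((-1 : ℝ) / 2) * nk * nT + ((-1 : ℝ) / 2) * nk * nij) * z) h_sum,
            (by positivity : (0:ℝ) ≤ ((1 : ℝ) / 2) * nk * (nij + nT) * (Z + nE + ni + nj + nk) + ((1 : ℝ) / 2) * nk
            * (nij + nik + njk + nT) * (nij + nT))]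
  · -- pair_P02_R1
    linarith only [mul_nonneg (by positivity : (0:ℝ) ≤ (1 : ℝ) * (Z + nE + ni + nj + nk))
            (sub_nonneg.2 h_fkg_Aa02), congrArg (fun z : ℝ =>
            ((-1 : ℝ) * nT * nT + (-1 : ℝ) * nij * nT + (-1 : ℝ) * nij * nik + (-1 : ℝ) * nik * nT + (-1 : ℝ) * nik
            * njk + ((-1 : ℝ) / 2) * nj * nT + ((-1 : ℝ) / 2) * nj * nik + (-1 : ℝ) * njk * nT) * z) h_sum,
            (by positivity : (0:ℝ) ≤ ((1 : ℝ) / 2) * nj * (nik + nT) * (Z + nE + ni + nj + nk) + ((1 : ℝ) / 2) * nj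
            * (nij + nik + njk + nT) * (nik + nT))]
  · -- pair_P12_R0
    linarith only [mul_nonneg (by positivity : (0:ℝ) ≤ (1 : ℝ) * (Z + nE + ni + nj + nk))
            (sub_nonneg.2 h_fkg_Aa12), congrArg (fun z : ℝ =>
            ((-1 : ℝ) * nT * nT + ((-1 : ℝ) / 2) * ni * nT + ((-1 : ℝ) / 2) * ni * njk + (-1 : ℝ) * nij * nT +
            (-1 : ℝ) * nij * njk + (-1 : ℝ) * nik * nT + (-1 : ℝ) * nik * njk + (-1 : ℝ) * njk * nT) * z) h_sum,
            (by positivity : (0:ℝ) ≤ ((1 : ℝ) / 2) * ni * (njk + nT) * (Z + nE + ni + nj + nk) + ((1 : ℝ) / 2) * ni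
            * (nij + nik + njk + nT) * (njk + nT))]

/-- **Regime A** (top full, uniform rank-2 fill: `r_xy = Z·n_xy·(Z − δ)`, `δ·N₂ = d·n_⊤`, `r_⊤ = Z(Z+d)n_⊤`), valid
        when `d·n_⊤ ≤ Z·N₂` and the three single-atom Hall inequalities `n_x·n_yz ≤ (d − n_x)·σ_x` hold.
        [this work] Part 3: the core pair inequalities `↑x` vs `↑x` and `↑x` vs `↑y`, explicit retained masses. -/
theorem cert_A_pairsR (nE ni nj nk nij nik njk nT Z : ℝ)
    (h_nn_E : 0 ≤ nE) (h_nn_0 : 0 ≤ ni) (h_nn_1 : 0 ≤ nj) (h_nn_2 : 0 ≤ nk) (h_nn_01 : 0 ≤ nij) (h_nn_02 : 0 ≤ nik)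
    (h_nn_12 : 0 ≤ njk) (h_nn_T : 0 ≤ nT) (h_nn_Z : 0 ≤ Z) (h_sum : Z = nE + ni + nj + nk + nij + nik + njk + nT)
    (h_fkg_aa01 : (ni + nij + nik + nT) * (nj + nij + njk + nT) ≤ Z * (nij + nT))
    (h_fkg_aa02 : (ni + nij + nik + nT) * (nk + nik + njk + nT) ≤ Z * (nik + nT))
    (h_fkg_aa12 : (nj + nij + njk + nT) * (nk + nik + njk + nT) ≤ Z * (njk + nT))
    (h_fkg_Aa01 : (nij + nT) * (nk + nik + njk + nT) ≤ Z * nT)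
    (h_fkg_Aa02 : (nik + nT) * (nj + nij + njk + nT) ≤ Z * nT) (hN2pos : 0 < nij + nik + njk) (dl : ℝ)
    (hdl : dl * (nij + nik + njk) = (nE + ni + nj + nk) * nT) (hdl0 : 0 ≤ dl) :
    Z * ((ni + nij + nik + nT) * (nij + nik + nT) + (ni + nij + nik + nT) * (nij + nik + nT)) -
            (nij + nik + njk + nT) * (ni + nij + nik + nT) * (ni + nij + nik + nT) ≤ (Z*nij*(Z - dl)) +
            (Z*nik*(Z - dl)) + (Z*(Z + (nE + ni + nj + nk))*nT) ∧
    Z *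
            ((nj + nij + njk + nT) * (nij + njk + nT) + (nj + nij + njk + nT) * (nij + njk + nT)) -
            (nij + nik + njk + nT) * (nj + nij + njk + nT) * (nj + nij + njk + nT) ≤ (Z*nij*(Z - dl)) +
            (Z*njk*(Z - dl)) + (Z*(Z + (nE + ni + nj + nk))*nT) ∧
    Z *
            ((nk + nik + njk + nT) * (nik + njk + nT) + (nk + nik + njk + nT) * (nik + njk + nT)) -
            (nij + nik + njk + nT) * (nk + nik + njk + nT) * (nk + nik + njk + nT) ≤ (Z*nik*(Z - dl)) +
            (Z*njk*(Z - dl)) + (Z*(Z + (nE + ni + nj + nk))*nT) ∧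
    Z *
            ((ni + nij + nik + nT) * (nij + njk + nT) + (nj + nij + njk + nT) * (nij + nik + nT)) -
            (nij + nik + njk + nT) * (ni + nij + nik + nT) * (nj + nij + njk + nT) ≤ (Z*nij*(Z - dl)) +
            (Z*(Z + (nE + ni + nj + nk))*nT) ∧
    Z * ((ni + nij + nik + nT) * (nik + njk + nT) +
            (nk + nik + njk + nT) * (nij + nik + nT)) - (nij + nik + njk + nT) * (ni + nij + nik + nT) *
            (nk + nik + njk + nT) ≤ (Z*nik*(Z - dl)) + (Z*(Z + (nE + ni + nj + nk))*nT) ∧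
    Z *
            ((nj + nij + njk + nT) * (nik + njk + nT) + (nk + nik + njk + nT) * (nij + njk + nT)) -
            (nij + nik + njk + nT) * (nj + nij + njk + nT) * (nk + nik + njk + nT) ≤ (Z*njk*(Z - dl)) +
            (Z*(Z + (nE + ni + nj + nk))*nT) := by
  refine ⟨?_, ?_, ?_, ?_, ?_, ?_⟩
  · -- pair_R0_R0
    linarith only [congrArg (fun z : ℝ => ((-1 : ℝ) * Z) * z) hdl, congrArg
            (fun z : ℝ => ((1 : ℝ) * nE * nT + (1 : ℝ) * nE * nij + (1 : ℝ) * nE * nik + (1 : ℝ) * nT * Z +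
            (-1 : ℝ) * nT * nT + (-1 : ℝ) * ni * nT + (-1 : ℝ) * ni * nij + (-1 : ℝ) * ni * nik + (1 : ℝ) * nij * Z
            + (-2 : ℝ) * nij * nT + (-1 : ℝ) * nij * nij + (-2 : ℝ) * nij * nik + (1 : ℝ) * nij * njk + (1 : ℝ) *
            nik * Z + (-2 : ℝ) * nik * nT + (-1 : ℝ) * nik * nik + (1 : ℝ) * nik * njk + (1 : ℝ) * nj * nT +
            (1 : ℝ) * nj * nij + (1 : ℝ) * nj * nik + (1 : ℝ) * njk * nT + (1 : ℝ) * nk * nT + (1 : ℝ) * nk * nij +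
            (1 : ℝ) * nk * nik) * z) h_sum, (by positivity : (0:ℝ) ≤ (1 : ℝ) * (nij + nik + nT) *
            (nE + nj + nk + njk) * (nE + nj + nk + njk) + (1 : ℝ) * njk * Z * dl + (1 : ℝ) * njk *
            (ni + nij + nik + nT) * (ni + nij + nik + nT))]
  · -- pair_R1_R1
    linarith only [congrArg (fun z : ℝ => ((-1 : ℝ) * Z) * z) hdl, congrArg
            (fun z : ℝ => ((1 : ℝ) * nE * nT + (1 : ℝ) * nE * nij + (1 : ℝ) * nE * njk + (1 : ℝ) * nT * Z +
            (-1 : ℝ) * nT * nT + (1 : ℝ) * ni * nT + (1 : ℝ) * ni * nij + (1 : ℝ) * ni * njk + (1 : ℝ) * nij * Z +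
            (-2 : ℝ) * nij * nT + (-1 : ℝ) * nij * nij + (1 : ℝ) * nij * nik + (-2 : ℝ) * nij * njk + (1 : ℝ) * nik
            * nT + (1 : ℝ) * nik * njk + (-1 : ℝ) * nj * nT + (-1 : ℝ) * nj * nij + (-1 : ℝ) * nj * njk + (1 : ℝ) *
            njk * Z + (-2 : ℝ) * njk * nT + (-1 : ℝ) * njk * njk + (1 : ℝ) * nk * nT + (1 : ℝ) * nk * nij + (1 : ℝ)
            * nk * njk) * z) h_sum, (by positivity : (0:ℝ) ≤ (1 : ℝ) * (nij + njk + nT) * (nE + ni + nk + nik) *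
            (nE + ni + nk + nik) + (1 : ℝ) * nik * Z * dl + (1 : ℝ) * nik * (nj + nij + njk + nT) *
            (nj + nij + njk + nT))]
  · -- pair_R2_R2
    linarith only [congrArg (fun z : ℝ => ((-1 : ℝ) * Z) * z) hdl, congrArg
            (fun z : ℝ => ((1 : ℝ) * nE * nT + (1 : ℝ) * nE * nik + (1 : ℝ) * nE * njk + (1 : ℝ) * nT * Z +
            (-1 : ℝ) * nT * nT + (1 : ℝ) * ni * nT + (1 : ℝ) * ni * nik + (1 : ℝ) * ni * njk + (1 : ℝ) * nij * nT +
            (1 : ℝ) * nij * nik + (1 : ℝ) * nij * njk + (1 : ℝ) * nik * Z + (-2 : ℝ) * nik * nT + (-1 : ℝ) * nik *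
            nik + (-2 : ℝ) * nik * njk + (1 : ℝ) * nj * nT + (1 : ℝ) * nj * nik + (1 : ℝ) * nj * njk + (1 : ℝ) *
            njk * Z + (-2 : ℝ) * njk * nT + (-1 : ℝ) * njk * njk + (-1 : ℝ) * nk * nT + (-1 : ℝ) * nk * nik +
            (-1 : ℝ) * nk * njk) * z) h_sum, (by positivity : (0:ℝ) ≤ (1 : ℝ) * (nik + njk + nT) *
            (nE + ni + nj + nij) * (nE + ni + nj + nij) + (1 : ℝ) * nij * Z * dl + (1 : ℝ) * nij *
            (nk + nik + njk + nT) * (nk + nik + njk + nT))]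
  · -- pair_R0_R1
    refine le_of_mul_le_mul_left ?_ (a := (nij + nik + njk)) hN2pos
    linarith only [mul_nonneg (by positivity : (0:ℝ) ≤ (1 : ℝ) * Z * (nik + njk)) (sub_nonneg.2 h_fkg_Aa02),
            mul_nonneg (by positivity : (0:ℝ) ≤ (1 : ℝ) * (nE + ni + nj + nk) * (nij + nik + njk))
            (sub_nonneg.2 h_fkg_aa01), congrArg (fun z : ℝ => ((-1 : ℝ) * nij * Z) * z) hdl, congrArg
            (fun z : ℝ => ((-1 : ℝ) * ni * nij * nT + (-1 : ℝ) * ni * nij * nij + (-1 : ℝ) * ni * nij * nik +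
            (-2 : ℝ) * ni * nij * njk + (-1 : ℝ) * ni * nik * nT + (-1 : ℝ) * ni * nik * njk + ((-1 : ℝ) / 2) * ni
            * nj * nij + ((-1 : ℝ) / 2) * ni * nj * nik + ((-1 : ℝ) / 2) * ni * nj * njk + (-1 : ℝ) * ni * njk * nT
            + (-1 : ℝ) * ni * njk * njk + (1 : ℝ) * nij * nT * Z + (-1 : ℝ) * nij * nT * nT + (1 : ℝ) * nij * nij *
            Z + (-2 : ℝ) * nij * nij * nT + (-1 : ℝ) * nij * nij * nij + (-2 : ℝ) * nij * nij * nik + (-2 : ℝ) *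
            nij * nij * njk + (1 : ℝ) * nij * nik * Z + (-3 : ℝ) * nij * nik * nT + ((-1 : ℝ) / 2) * nij * nik *
            nik + (-3 : ℝ) * nij * nik * njk + (1 : ℝ) * nij * njk * Z + (-3 : ℝ) * nij * njk * nT + (-1 : ℝ) * nij
            * njk * njk + (-1 : ℝ) * nik * nT * nT + (-1 : ℝ) * nik * nik * nT + (-1 : ℝ) * nik * nik * njk +
            (-2 : ℝ) * nik * njk * nT + (-1 : ℝ) * nik * njk * njk + (-1 : ℝ) * nj * nij * nT + (-1 : ℝ) * nj * nij
            * nij + (-2 : ℝ) * nj * nij * nik + (-1 : ℝ) * nj * nij * njk + ((-1 : ℝ) / 2) * nj * nik * nT +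
            ((-1 : ℝ) / 2) * nj * nik * nik + ((-1 : ℝ) / 2) * nj * nik * njk + ((-1 : ℝ) / 2) * nj * njk * nT +
            (-1 : ℝ) * njk * nT * nT + (-1 : ℝ) * njk * njk * nT) * z) h_sum,
            (by positivity : (0:ℝ) ≤ ((1 : ℝ) / 2) * ni * nj * (nij + nik + njk) * (Z + nE + ni + nj + nk) +
            ((1 : ℝ) / 2) * ni * nj * (nij + nik + njk + nT) * (nij + nik + njk) + ((1 : ℝ) / 2) * nij * nik * nik
            * (Z + nE + ni + nj + nk) + ((1 : ℝ) / 2) * nij * nik * nik * (nij + nik + njk + nT) + ((1 : ℝ) / 2) *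
            nj * (nik + njk) * (nik + nT) * (Z + nE + ni + nj + nk) + ((1 : ℝ) / 2) * nj * (nij + nik + njk + nT) *
            (nik + njk) * (nik + nT))]
  · -- pair_R0_R2
    refine le_of_mul_le_mul_left ?_ (a := (nij + nik + njk)) hN2pos
    linarith only [mul_nonneg (by positivity : (0:ℝ) ≤ (1 : ℝ) * Z * (nij + njk)) (sub_nonneg.2 h_fkg_Aa01),
            mul_nonneg (by positivity : (0:ℝ) ≤ (1 : ℝ) * (nE + ni + nj + nk) * (nij + nik + njk))
            (sub_nonneg.2 h_fkg_aa02), congrArg (fun z : ℝ => ((-1 : ℝ) * nik * Z) * z) hdl, congrArg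
            (fun z : ℝ => ((-1 : ℝ) * ni * nij * nT + (-1 : ℝ) * ni * nij * nik + (-1 : ℝ) * ni * nij * njk +
            (-1 : ℝ) * ni * nik * nT + (-1 : ℝ) * ni * nik * nik + (-2 : ℝ) * ni * nik * njk + (-1 : ℝ) * ni * njk
            * nT + (-1 : ℝ) * ni * njk * njk + ((-1 : ℝ) / 2) * ni * nk * nij + ((-1 : ℝ) / 2) * ni * nk * nik +
            ((-1 : ℝ) / 2) * ni * nk * njk + (-1 : ℝ) * nij * nT * nT + (-1 : ℝ) * nij * nij * nT + ((-1 : ℝ) / 2)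
            * nij * nij * nik + (-1 : ℝ) * nij * nij * njk + (1 : ℝ) * nij * nik * Z + (-3 : ℝ) * nij * nik * nT +
            (-2 : ℝ) * nij * nik * nik + (-3 : ℝ) * nij * nik * njk + (-2 : ℝ) * nij * njk * nT + (-1 : ℝ) * nij *
            njk * njk + (1 : ℝ) * nik * nT * Z + (-1 : ℝ) * nik * nT * nT + (1 : ℝ) * nik * nik * Z + (-2 : ℝ) *
            nik * nik * nT + (-1 : ℝ) * nik * nik * nik + (-2 : ℝ) * nik * nik * njk + (1 : ℝ) * nik * njk * Z +
            (-3 : ℝ) * nik * njk * nT + (-1 : ℝ) * nik * njk * njk + (-1 : ℝ) * njk * nT * nT + (-1 : ℝ) * njk *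
            njk * nT + ((-1 : ℝ) / 2) * nk * nij * nT + ((-1 : ℝ) / 2) * nk * nij * nij + (-2 : ℝ) * nk * nij * nik
            + ((-1 : ℝ) / 2) * nk * nij * njk + (-1 : ℝ) * nk * nik * nT + (-1 : ℝ) * nk * nik * nik + (-1 : ℝ) *
            nk * nik * njk + ((-1 : ℝ) / 2) * nk * njk * nT) * z) h_sum,
            (by positivity : (0:ℝ) ≤ ((1 : ℝ) / 2) * ni * nk * (nij + nik + njk) * (Z + nE + ni + nj + nk) +
            ((1 : ℝ) / 2) * ni * nk * (nij + nik + njk + nT) * (nij + nik + njk) + ((1 : ℝ) / 2) * nij * nij * nik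
            * (Z + nE + ni + nj + nk) + ((1 : ℝ) / 2) * nij * nij * nik * (nij + nik + njk + nT) + ((1 : ℝ) / 2) *
            nk * (nij + njk) * (nij + nT) * (Z + nE + ni + nj + nk) + ((1 : ℝ) / 2) * nk * (nij + nik + njk + nT) *
            (nij + njk) * (nij + nT))]
  · -- pair_R1_R2
    refine le_of_mul_le_mul_left ?_ (a := (nij + nik + njk)) hN2pos
    linarith only [mul_nonneg (by positivity : (0:ℝ) ≤ (1 : ℝ) * Z * (nij + nik)) (sub_nonneg.2 h_fkg_Aa01),
            mul_nonneg (by positivity : (0:ℝ) ≤ (1 : ℝ) * (nE + ni + nj + nk) * (nij + nik + njk))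
            (sub_nonneg.2 h_fkg_aa12), congrArg (fun z : ℝ => ((-1 : ℝ) * njk * Z) * z) hdl, congrArg
            (fun z : ℝ => ((-1 : ℝ) * nij * nT * nT + (-1 : ℝ) * nij * nij * nT + (-1 : ℝ) * nij * nij * nik +
            ((-1 : ℝ) / 2) * nij * nij * njk + (-2 : ℝ) * nij * nik * nT + (-1 : ℝ) * nij * nik * nik + (-3 : ℝ) *
            nij * nik * njk + (1 : ℝ) * nij * njk * Z + (-3 : ℝ) * nij * njk * nT + (-2 : ℝ) * nij * njk * njk +
            (-1 : ℝ) * nik * nT * nT + (-1 : ℝ) * nik * nik * nT + (-1 : ℝ) * nik * nik * njk + (1 : ℝ) * nik * njk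
            * Z + (-3 : ℝ) * nik * njk * nT + (-2 : ℝ) * nik * njk * njk + (-1 : ℝ) * nj * nij * nT + (-1 : ℝ) * nj
            * nij * nik + (-1 : ℝ) * nj * nij * njk + (-1 : ℝ) * nj * nik * nT + (-1 : ℝ) * nj * nik * nik +
            (-2 : ℝ) * nj * nik * njk + (-1 : ℝ) * nj * njk * nT + (-1 : ℝ) * nj * njk * njk + ((-1 : ℝ) / 2) * nj
            * nk * nij + ((-1 : ℝ) / 2) * nj * nk * nik + ((-1 : ℝ) / 2) * nj * nk * njk + (1 : ℝ) * njk * nT * Z +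
            (-1 : ℝ) * njk * nT * nT + (1 : ℝ) * njk * njk * Z + (-2 : ℝ) * njk * njk * nT + (-1 : ℝ) * njk * njk *
            njk + ((-1 : ℝ) / 2) * nk * nij * nT + ((-1 : ℝ) / 2) * nk * nij * nij + ((-1 : ℝ) / 2) * nk * nij *
            nik + (-2 : ℝ) * nk * nij * njk + ((-1 : ℝ) / 2) * nk * nik * nT + (-1 : ℝ) * nk * nik * njk + (-1 : ℝ)
            * nk * njk * nT + (-1 : ℝ) * nk * njk * njk) * z) h_sum,
            (by positivity : (0:ℝ) ≤ ((1 : ℝ) / 2) * nij * nij * njk * (Z + nE + ni + nj + nk) + ((1 : ℝ) / 2) *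
            nij * nij * njk * (nij + nik + njk + nT) + ((1 : ℝ) / 2) * nj * nk * (nij + nik + njk) *
            (Z + nE + ni + nj + nk) + ((1 : ℝ) / 2) * nj * nk * (nij + nik + njk + nT) * (nij + nik + njk) +
            ((1 : ℝ) / 2) * nk * (nij + nik) * (nij + nT) * (Z + nE + ni + nj + nk) + ((1 : ℝ) / 2) * nk *
            (nij + nik + njk + nT) * (nij + nik) * (nij + nT))]

end Summit.CriticalPhenomena.PercolationContinuityZ3.Theorems.SahiE3MajCert
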